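import Summits.ResolutionOfSingularities.ResolutionOfSingularities.Theorems.AbsoluteContactPrimitives
import Summits.ResolutionOfSingularities.ResolutionOfSingularities.Theorems.ForcedTowerClasses

/-!
# KResidue — residue fields along a forced point tower are algebraic over the ground field (Layer C4 of the tower dictionary)

0-weight TOOL toward `TightDefectClasses.TowerDictionary` (decomp-res lens-5, g39; plan `NEXT-g40.md` §6, item C4 "priced first").
The ONLY scheme-theoretic input of the base change `B_i ↦ B̃_i = (K·B_i)_{𝔴̃_i}` (`K = k̄`): the residue fields `κ_i = κ(x_i)` of the CLOSED points
`x_i = T.pt i` of a forced point tower are algebraic over `k`, so that `κ_i ⊗_k K` is integral over `K` and the `K`-saturation `B̃_i` has residue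
field `K` (`KThread.exists_sub_algebraMap_mem_maximalIdeal`).

* §1 `baseMap T χ₀ i : T.St i ⟶ Spec k` — the structure map of stage `i` (`π_{i-1} ≫ ⋯ ≫ π_0 ≫ χ₀`); `locallyOfFiniteType_baseMap` — it is locally of
  finite type (blow-ups of locally Noetherian schemes are proper: `IsBlowup.isProper`); `rootMap` / `locallyOfFiniteType_rootMap` — the root structure
  `X_0 ≅ 𝔸⁴_k → Spec k` of a `Rooted` tower qualifies as `χ₀`.
* §2 `module_finite_residueField_pt` — `κ(x_i)` is FINITE over `k` (the tree's `AbsoluteContactClasses.module_finite_residueField_of_isClosed` at the closed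
  point `T.pt i`); `exists_poly_residueField_pt` — the same in instance-free form (every element of `κ(x_i)` is a root of a non-zero `k`-polynomial
  evaluated through `stalkHom`).
* §3 `stalkHom_succ_apply` — the structure map of stage `i+1` factors through `π_i^♯` on stalks (so its scalars land in `B_i ⊆ B_{i+1}`).
* §4 **`isAlgebraic_residueField_of_factor`** (pure algebra) — algebraicity CLIMBS a local homomorphism `R → R'`: if `κ(R)` is algebraic over `k` and
  `κ(R')` is algebraic over an auxiliary structure `φ : k → R'` factoring through `R`, then `κ(R')` is algebraic over `k`.
* §5 **`module_finite_residueField_of_isLocalization`** (pure algebra) — stage `0`: the residue field of a localisation of a finite-type `k`-algebra at a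
  MAXIMAL ideal is finite over `k` (Zariski's lemma).

All PROVED, 0 sorry.  [cite: GortzWedhorn2020, Prop. 3.33, Prop. 13.96] (closed points of schemes locally of finite type over a field; blow-ups proper).
-/

noncomputable section

set_option linter.dupNamespace false

namespace Summit.ResolutionOfSingularities.ResolutionOfSingularities.Theorems.KResidue

open CategoryTheory AlgebraicGeometry IsLocalRing Polynomial
open Literature.AlgebraicGeometry.Resolution
open Summit.ResolutionOfSingularities.ResolutionOfSingularities.Theorems.ForcedTowerClasses
open Summit.ResolutionOfSingularities.ResolutionOfSingularities.Theorems.AbsoluteContactClasses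

/-! ## §1 Structure maps of the stages -/

section Stages

variable {k : Type} [Field k]

/-- The `k`-structure of stage `i` of a forced tower rooted over `k` by `χ₀ : X_0 → Spec k`: `χ_i = π_{i-1} ≫ ⋯ ≫ π_0 ≫ χ₀`.  DEFINITION (support, data). -/
def baseMap (T : ForcedTower) (χ₀ : T.St 0 ⟶ Spec (.of k)) : ∀ i : ℕ, T.St i ⟶ Spec (.of k)
  | 0 => χ₀
  | i + 1 => T.π i ≫ baseMap T χ₀ i

/-- `χ_0 = χ₀`. -/
theorem baseMap_zero (T : ForcedTower) (χ₀ : T.St 0 ⟶ Spec (.of k)) : baseMap T χ₀ 0 = χ₀ := rfl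

/-- `χ_{i+1} = π_i ≫ χ_i`. -/
theorem baseMap_succ (T : ForcedTower) (χ₀ : T.St 0 ⟶ Spec (.of k)) (i : ℕ) : baseMap T χ₀ (i + 1) = T.π i ≫ baseMap T χ₀ i := rfl

/-- **Every stage is locally of finite type over `k`** (if stage `0` is): the blow-up `π_i` of the locally Noetherian `X_i` is proper
(`IsBlowup.isProper`), hence locally of finite type. [cite: GortzWedhorn2020, Prop. 13.96] -/
theorem locallyOfFiniteType_baseMap (T : ForcedTower) (χ₀ : T.St 0 ⟶ Spec (.of k)) [LocallyOfFiniteType χ₀] :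
    ∀ i : ℕ, LocallyOfFiniteType (baseMap T χ₀ i)
  | 0 => ‹LocallyOfFiniteType χ₀›
  | i + 1 => by
    haveI := locallyOfFiniteType_baseMap T χ₀ i
    haveI : IsLocallyNoetherian (T.St i) := LocallyOfFiniteType.isLocallyNoetherian (baseMap T χ₀ i)
    haveI : IsProper (T.π i) := (T.isBlowup i).isProper
    rw [baseMap_succ]
    infer_instance

/-- The ROOT structure map of a tower rooted at the polynomial pure head: `X_0 ≅ 𝔸⁴_k = Spec k[u₁,u₂,u₃][Z] → Spec k` (`ι` from `TightDefectClasses.Rooted`;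
`PureAmbient k` unfolded).  DEFINITION (support, data). -/
def rootMap (T : ForcedTower) (ι : Spec (CommRingCat.of (Polynomial (MvPolynomial (Fin 3) k))) ≅ T.St 0) : T.St 0 ⟶ Spec (.of k) :=
  ι.inv ≫ Spec.map (CommRingCat.ofHom (algebraMap k (Polynomial (MvPolynomial (Fin 3) k))))

/-- The root structure map is locally of finite type (`k[u][Z]` is of finite type over `k`). [folklore] -/
theorem locallyOfFiniteType_rootMap (T : ForcedTower) (ι : Spec (CommRingCat.of (Polynomial (MvPolynomial (Fin 3) k))) ≅ T.St 0) :
    LocallyOfFiniteType (rootMap T ι) := by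
  haveI : LocallyOfFiniteType (Spec.map (CommRingCat.ofHom (algebraMap k (Polynomial (MvPolynomial (Fin 3) k))))) :=
    (HasRingHomProperty.Spec_iff (P := @LocallyOfFiniteType)).mpr (RingHom.finiteType_algebraMap.mpr inferInstance)
  unfold rootMap
  infer_instance

/-- The `k`-structure `k → Γ(X_i, 𝒪) → 𝒪_{X_i, x}` of the stalks of stage `i` (the tree's `stalkHom`).  DEFINITION (support, abbreviation). -/
abbrev stalkStr (T : ForcedTower) (χ₀ : T.St 0 ⟶ Spec (.of k)) (i : ℕ) (x : T.St i) : k →+* (T.St i).presheaf.stalk x :=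
  stalkHom ((baseMap T χ₀ i).appTop.hom.comp (Scheme.ΓSpecIso (.of k)).inv.hom) x

/-! ## §2 Residue fields of the tower points are finite over `k` -/

/-- **`κ(x_i)` is finite over `k`** (`x_i = T.pt i` is CLOSED and `X_i → Spec k` is locally of finite type). [cite: GortzWedhorn2020, Prop. 3.33] -/
theorem module_finite_residueField_pt (T : ForcedTower) (χ₀ : T.St 0 ⟶ Spec (.of k)) [LocallyOfFiniteType χ₀] (i : ℕ) :
    letI := (stalkStr T χ₀ i (T.pt i)).toAlgebra
    Module.Finite k (ResidueField ((T.St i).presheaf.stalk (T.pt i))) := by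
  haveI := locallyOfFiniteType_baseMap T χ₀ i
  exact module_finite_residueField_of_isClosed (baseMap T χ₀ i) (T.isClosed_pt i)

/-- Instance-free form: every element of `κ(x_i)` is a root of a non-zero polynomial over `k` (evaluated through `stalkStr`). -/
theorem exists_poly_residueField_pt (T : ForcedTower) (χ₀ : T.St 0 ⟶ Spec (.of k)) [LocallyOfFiniteType χ₀] (i : ℕ)
    (x : ResidueField ((T.St i).presheaf.stalk (T.pt i))) :
    ∃ P : Polynomial k, P ≠ 0 ∧ P.eval₂ ((residue _).comp (stalkStr T χ₀ i (T.pt i))) x = 0 := by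
  letI := (stalkStr T χ₀ i (T.pt i)).toAlgebra
  haveI := module_finite_residueField_pt T χ₀ i
  haveI : Algebra.IsAlgebraic k (ResidueField ((T.St i).presheaf.stalk (T.pt i))) := Algebra.IsAlgebraic.of_finite k _
  obtain ⟨P, hP0, hPx⟩ := Algebra.IsAlgebraic.isAlgebraic (R := k) x
  exact ⟨P, hP0, by rwa [Polynomial.aeval_def] at hPx⟩

/-! ## §3 The structure of stage `i+1` factors through `π_i^♯` -/

/-- **Scalars descend one stage**: the scalar germ `c ∈ 𝒪_{X_{i+1}, x_{i+1}}` is `π_i^♯` of the scalar germ at `π_i(x_{i+1})`. [folklore] -/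
theorem stalkHom_succ_apply (T : ForcedTower) (χ₀ : T.St 0 ⟶ Spec (.of k)) (i : ℕ) (c : k) :
    stalkStr T χ₀ (i + 1) (T.pt (i + 1)) c =
      ((T.π i).stalkMap (T.pt (i + 1))).hom (stalkStr T χ₀ i ((T.π i).base (T.pt (i + 1))) c) := by
  simp only [stalkStr, stalkHom, RingHom.coe_comp, Function.comp_apply, baseMap_succ, Scheme.Hom.comp_appTop, CommRingCat.hom_comp]
  symm
  exact Scheme.Hom.germ_stalkMap_apply (T.π i) ⊤ (T.pt (i + 1)) trivial _

/-- The same as a range statement: the scalars of stage `i+1` lie in the image of `π_i^♯`. -/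
theorem stalkStr_succ_mem_range (T : ForcedTower) (χ₀ : T.St 0 ⟶ Spec (.of k)) (i : ℕ) (c : k) :
    stalkStr T χ₀ (i + 1) (T.pt (i + 1)) c ∈ ((T.π i).stalkMap (T.pt (i + 1))).hom.range :=
  ⟨_, (stalkHom_succ_apply T χ₀ i c).symm⟩

end Stages

/-! ## §4 Algebraicity climbs local homomorphisms -/

section Climb

variable {k R R' : Type} [Field k] [CommRing R] [CommRing R'] [IsLocalRing R] [IsLocalRing R']
  [Algebra k R] [Algebra k R'] [Algebra R R'] [IsScalarTower k R R'] [IsLocalHom (algebraMap R R')]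

/-- **Algebraicity climbs.**  `R → R'` a local homomorphism of local `k`-algebras with `κ(R)` algebraic over `k`; `φ : k → R'` an auxiliary ring map whose
values come from `R` and over which `κ(R')` is algebraic (every element a root of a non-zero `k`-polynomial evaluated through `φ`).  Then `κ(R')` is
algebraic over `κ(R)` — lift the polynomial along `κ(R) → κ(R')` (`Polynomial.lifts`) — hence over `k`. [folklore] -/
theorem isAlgebraic_residueField_of_factor (φ : k →+* R') (hφ : ∀ c, φ c ∈ (algebraMap R R').range)
    (hfin : ∀ x : ResidueField R', ∃ P : Polynomial k, P ≠ 0 ∧ P.eval₂ ((residue R').comp φ) x = 0)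
    [Algebra.IsAlgebraic k (ResidueField R)] : Algebra.IsAlgebraic k (ResidueField R') := by
  haveI : Algebra.IsAlgebraic (ResidueField R) (ResidueField R') := by
    refine ⟨fun x => ?_⟩
    obtain ⟨P, hP0, hPx⟩ := hfin x
    have hinj : Function.Injective ((residue R').comp φ) := RingHom.injective _
    have hlifts : P.map ((residue R').comp φ) ∈ Polynomial.lifts (algebraMap (ResidueField R) (ResidueField R')) := by
      rw [Polynomial.lifts_iff_coeff_lifts]
      intro n
      rw [Polynomial.coeff_map]
      obtain ⟨a, ha⟩ := hφ (P.coeff n)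
      refine ⟨residue R a, ?_⟩
      rw [IsLocalRing.ResidueField.algebraMap_residue, RingHom.comp_apply, ← ha]
    obtain ⟨Q, hQ, hdeg⟩ := Polynomial.exists_degree_eq_of_mem_lifts hlifts
    refine ⟨Q, ?_, ?_⟩
    · intro hQ0
      rw [hQ0, Polynomial.degree_zero, Polynomial.degree_map_eq_of_injective hinj, eq_comm, Polynomial.degree_eq_bot] at hdeg
      exact hP0 hdeg
    · rw [Polynomial.aeval_def, Polynomial.eval₂_eq_eval_map, hQ, Polynomial.eval_map, hPx]
  exact Algebra.IsAlgebraic.trans k (ResidueField R) (ResidueField R')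

end Climb

/-! ## §5 Stage `0`: localisation of a finite-type algebra at a maximal ideal -/

section StageZero

variable {k A S : Type} [Field k] [CommRing A] [Algebra k A] [Algebra.FiniteType k A]
  [CommRing S] [IsLocalRing S] [Algebra A S] [Algebra k S] [IsScalarTower k A S]

/-- **Zariski's lemma for the stalk of a closed point** (stage `0` of the dictionary: `B_0 = k[u][Z]_𝔮`, `𝔮` maximal): the residue field of a
localisation `S = A_𝔮` of a finite-type `k`-algebra `A` at a MAXIMAL ideal is finite over `k` — `A → κ(S)` is onto, so `κ(S)` is a field of finite
type over `k`. [cite: GortzWedhorn2020, Prop. 3.33] -/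
theorem module_finite_residueField_of_isLocalization (𝔮 : Ideal A) [𝔮.IsMaximal] [IsLocalization.AtPrime S 𝔮] :
    Module.Finite k (ResidueField S) := by
  have hunder : ((maximalIdeal S).under A).IsMaximal := by
    rw [IsLocalization.AtPrime.under_maximalIdeal S 𝔮]
    infer_instance
  have hq := IsLocalization.surjective_quotientMap_of_maximal_of_localization 𝔮.primeCompl S
    (I := maximalIdeal S) (J := (⊥ : Ideal A)) (H := bot_le) hunder
  have hsurj : Function.Surjective ((residue S).comp (algebraMap A S)) := by
    intro t
    obtain ⟨a, ha⟩ := hq t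
    obtain ⟨a, rfl⟩ := Ideal.Quotient.mk_surjective a
    rw [Ideal.quotientMap_mk] at ha
    exact ⟨a, ha⟩
  have hcomp : algebraMap k (ResidueField S) = ((residue S).comp (algebraMap A S)).comp (algebraMap k A) := by
    rw [RingHom.comp_assoc, ← IsScalarTower.algebraMap_eq k A S]
    rfl
  have hFT : (algebraMap k (ResidueField S)).FiniteType := by
    rw [hcomp]
    exact (RingHom.FiniteType.of_surjective _ hsurj).comp (RingHom.finiteType_algebraMap.mpr inferInstance)
  haveI : Algebra.FiniteType k (ResidueField S) := RingHom.finiteType_algebraMap.mp hFT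
  exact finite_of_finite_type_of_isJacobsonRing k _

/-- Hence algebraic. -/
theorem isAlgebraic_residueField_of_isLocalization (𝔮 : Ideal A) [𝔮.IsMaximal] [IsLocalization.AtPrime S 𝔮] :
    Algebra.IsAlgebraic k (ResidueField S) := by
  haveI := module_finite_residueField_of_isLocalization (k := k) (S := S) 𝔮
  exact Algebra.IsAlgebraic.of_finite k _

end StageZero

end Summit.ResolutionOfSingularities.ResolutionOfSingularities.Theorems.KResidue
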